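import Summits.BirchSwinnertonDyer.BirchSwinnertonDyer.Theorems.ManinLocalTwoThreeNeronSqueeze
import Summits.BirchSwinnertonDyer.BirchSwinnertonDyer.Theorems.ManinLocalTwoThreeAnalyticBridge
import HarnessLib

/-!
# The Weierstrass squeeze: two `η`-identities of a globally minimal model force `|c| = 1` — general level

Cell bsd-f2-manin, route `ManinLocalTwoThree`; the general-`N` packaging of the level-`20`/`24` road
(`LevelTwenty`, `NeronSqueezeTwenty`; planner -an g50 §95).  Let `φ ∈ S₂(Γ₀(N))`, `φ ≠ 0`, let
`W₀ = [a₁, a₂, a₃, a₄, a₆]` be a globally minimal elliptic curve over `ℚ`, and let `x, y : ℍ → ℂ` be holomorphic,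
`x` invariant under `Γ₀(N)`, with

  (I1) `y² + a₁xy + a₃y = x³ + a₂x² + a₄x + a₆` and (I2) `x′ = −2πi φ · (2y + a₁x + a₃)` on `ℍ`,

and `2y + a₁x + a₃ ≢ 0`.  Then with `X = x + b₂/12` one has `(X′)² = (2πiφ)²(4X³ − g₂X − g₃)` for the Néron
invariants `g₂ = c₄(W₀)/12`, `g₃ = c₆(W₀)/216`, so the period lattice of `φ` lies in a Néron lattice of `W₀`
(`AnalyticBridge.periodLattice_le_of_deriv_sq` with `PeriodPair.uniformization_holds`;
`periodLattice_le_neronLattice_of_weierstrassIdentities`), and the NÉRON SQUEEZE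
(`NeronSqueeze.abs_maninConstant_eq_one_of_periodLattice_le`) gives: **every `X₀(N)`-datum `D` of a globally
minimal `W` with `D.f = φ` and the lattice clause has `|D.maninConstant| = 1`**
(`abs_maninConstant_eq_one_of_weierstrassIdentities`).  No complex multiplication, no modularity, no CDT,
no printed Manin-constant fact.  BSD is not proved by this.
-/

set_option autoImplicit false
set_option linter.dupNamespace false

noncomputable section

open Complex Filter Topology Set Function
open UpperHalfPlane hiding I
open scoped Real Topology Manifold MatrixGroups ModularForm
open ModularForm CongruenceSubgroup
open Literature.NumberTheory.EllipticCurves Literature.NumberTheory.EllipticCurves.ModularForms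
open Summit.BirchSwinnertonDyer.BirchSwinnertonDyer.Theorems.ManinLocalTwoThree

namespace Summit.BirchSwinnertonDyer.BirchSwinnertonDyer.Theorems.ManinLocalTwoThree.WeierstrassSqueeze

open AnalyticBridge

/-- `g₂³ − 27g₃² = Δ` for the Néron invariants `g₂ = c₄/12`, `g₃ = c₆/216` (`1728Δ = c₄³ − c₆²`), hence
`≠ 0` for an elliptic curve. [folklore] -/
theorem neron_invariants_discr_ne_zero (W₀ : WeierstrassCurve ℚ) [W₀.IsElliptic] :
    ((W₀.baseChange ℂ).c₄ / 12) ^ 3 - 27 * ((W₀.baseChange ℂ).c₆ / 216) ^ 2 ≠ 0 := by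
  have hΔ : (W₀.baseChange ℂ).Δ ≠ 0 := by
    have h := W₀.isUnit_Δ
    rw [isUnit_iff_ne_zero] at h
    simpa [WeierstrassCurve.baseChange, WeierstrassCurve.map_Δ] using h
  have hrel := (W₀.baseChange ℂ).c_relation
  intro h0
  apply hΔ
  have : ((W₀.baseChange ℂ).c₄ / 12) ^ 3 - 27 * ((W₀.baseChange ℂ).c₆ / 216) ^ 2
      = (1728 * (W₀.baseChange ℂ).Δ) / 1728 := by rw [hrel]; ring
  rw [this] at h0
  simpa using h0

/-- **(S2) from the two identities**: `Λ(φ)` lies in a Néron lattice of `W₀ = [a₁, a₂, a₃, a₄, a₆]`.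
[cite: CremonaAlgorithms1997, §2.10] -/
theorem periodLattice_le_neronLattice_of_weierstrassIdentities {N : ℕ} [NeZero N]
    (φ : CuspForm (Gamma0 N) 2) (hφ : φ ≠ 0) (a₁ a₂ a₃ a₄ a₆ : ℚ)
    [(⟨a₁, a₂, a₃, a₄, a₆⟩ : WeierstrassCurve ℚ).IsElliptic]
    (x y : ℍ → ℂ) (hx : MDifferentiable 𝓘(ℂ) 𝓘(ℂ) x)
    (hinv : ∀ (γ : Gamma0 N) (τ : ℍ), x ((γ : SL(2, ℤ)) • τ) = x τ)
    (hcubic : ∀ τ : ℍ, y τ ^ 2 + a₁ * x τ * y τ + a₃ * y τ = x τ ^ 3 + a₂ * x τ ^ 2 + a₄ * x τ + a₆)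
    (hderiv : ∀ τ : ℍ, deriv (x ∘ ofComplex) τ = -(2 * π * I * φ τ) * (2 * y τ + a₁ * x τ + a₃))
    (hnd : ∃ τ₀ : ℍ, 2 * y τ₀ + a₁ * x τ₀ + a₃ ≠ 0) :
    ∃ L : PeriodPair, IsNeronLatticeOf ((⟨a₁, a₂, a₃, a₄, a₆⟩ : WeierstrassCurve ℚ).baseChange ℂ) L ∧
      ∀ z ∈ periodLattice φ, z ∈ L.lattice := by
  set W₀ : WeierstrassCurve ℚ := ⟨a₁, a₂, a₃, a₄, a₆⟩ with hW₀
  obtain ⟨L, hg2, hg3⟩ := PeriodPair.uniformization_holds ((W₀.baseChange ℂ).c₄ / 12)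
    ((W₀.baseChange ℂ).c₆ / 216) (neron_invariants_discr_ne_zero W₀)
  have hc4 : (W₀.baseChange ℂ).c₄ = ((a₁ ^ 2 + 4 * a₂) ^ 2 - 24 * (2 * a₄ + a₁ * a₃) : ℚ) := by
    simp [WeierstrassCurve.baseChange, hW₀, WeierstrassCurve.c₄, WeierstrassCurve.b₂,
      WeierstrassCurve.b₄]
  have hc6 : (W₀.baseChange ℂ).c₆ = (-(a₁ ^ 2 + 4 * a₂) ^ 3 + 36 * (a₁ ^ 2 + 4 * a₂) * (2 * a₄ + a₁ * a₃)
      - 216 * (a₃ ^ 2 + 4 * a₆) : ℚ) := by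
    simp [WeierstrassCurve.baseChange, hW₀, WeierstrassCurve.c₆, WeierstrassCurve.b₂,
      WeierstrassCurve.b₄, WeierstrassCurve.b₆]
  refine ⟨L, ⟨hg2, hg3⟩, ?_⟩
  refine periodLattice_le_of_deriv_sq φ hφ L (fun τ ↦ x τ + ((a₁ ^ 2 + 4 * a₂) / 12 : ℚ))
    (hx.add mdifferentiable_const) (fun γ τ ↦ by simp only [hinv γ τ]) ?_ ?_
  · intro τ
    have hd : deriv ((fun σ : ℍ ↦ x σ + (((a₁ ^ 2 + 4 * a₂) / 12 : ℚ) : ℂ)) ∘ ofComplex) τ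
        = deriv (x ∘ ofComplex) τ := by
      rw [show ((fun σ : ℍ ↦ x σ + (((a₁ ^ 2 + 4 * a₂) / 12 : ℚ) : ℂ)) ∘ ofComplex)
        = fun z ↦ (x ∘ ofComplex) z + (((a₁ ^ 2 + 4 * a₂) / 12 : ℚ) : ℂ) from rfl, deriv_add_const]
    rw [hd, hderiv τ, hg2, hg3, hc4, hc6]
    push_cast
    linear_combination (4 * (2 * π * I * φ τ) ^ 2) * hcubic τ
  · obtain ⟨τ₀, h0⟩ := hnd
    refine ⟨τ₀, ?_⟩
    rw [hg2, hg3, hc4, hc6]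
    push_cast
    have hsq : (2 * y τ₀ + a₁ * x τ₀ + a₃) ^ 2 ≠ 0 := pow_ne_zero 2 h0
    intro h
    apply hsq
    linear_combination h + 4 * hcubic τ₀

/-- **The Weierstrass squeeze.**  `φ ∈ S₂(Γ₀(N))` non-zero; `W₀ = [a₁, …, a₆]` globally minimal; `x, y`
holomorphic on `ℍ`, `x` `Γ₀(N)`-invariant, with the curve identity (I1) and the derivative identity (I2) and
`2y + a₁x + a₃ ≢ 0`.  Then every `X₀(N)`-datum `D` of a globally minimal `W/ℚ` with `D.f = φ` and the lattice
clause `Λ_W = c·Λ_f` has `|c| = 1`. [cite: AgasheRibetStein2006, §§1–2] [cite: CremonaAlgorithms1997, §2.10] -/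
theorem abs_maninConstant_eq_one_of_weierstrassIdentities {N : ℕ} [NeZero N]
    (φ : CuspForm (Gamma0 N) 2) (hφ : φ ≠ 0) (a₁ a₂ a₃ a₄ a₆ : ℚ)
    [(⟨a₁, a₂, a₃, a₄, a₆⟩ : WeierstrassCurve ℚ).IsElliptic]
    [(⟨a₁, a₂, a₃, a₄, a₆⟩ : WeierstrassCurve ℚ).IsGloballyMinimal]
    (x y : ℍ → ℂ) (hx : MDifferentiable 𝓘(ℂ) 𝓘(ℂ) x)
    (hinv : ∀ (γ : Gamma0 N) (τ : ℍ), x ((γ : SL(2, ℤ)) • τ) = x τ)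
    (hcubic : ∀ τ : ℍ, y τ ^ 2 + a₁ * x τ * y τ + a₃ * y τ = x τ ^ 3 + a₂ * x τ ^ 2 + a₄ * x τ + a₆)
    (hderiv : ∀ τ : ℍ, deriv (x ∘ ofComplex) τ = -(2 * π * I * φ τ) * (2 * y τ + a₁ * x τ + a₃))
    (hnd : ∃ τ₀ : ℍ, 2 * y τ₀ + a₁ * x τ₀ + a₃ ≠ 0)
    (W : WeierstrassCurve ℚ) [W.IsElliptic] [W.IsGloballyMinimal] (D : ModularParametrizationData W N)
    (hf : D.f = φ) (hopt : ∀ z ∈ D.L.lattice, ∃ w ∈ periodLattice D.f, z = D.c * w) :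
    |D.maninConstant| = 1 := by
  obtain ⟨L, hL, hle⟩ := periodLattice_le_neronLattice_of_weierstrassIdentities φ hφ a₁ a₂ a₃ a₄ a₆ x y hx
    hinv hcubic hderiv hnd
  refine NeronSqueeze.abs_maninConstant_eq_one_of_periodLattice_le (⟨a₁, a₂, a₃, a₄, a₆⟩ : WeierstrassCurve ℚ)
    L hL W D (fun z hz ↦ hle z ?_) hopt
  rwa [hf] at hz

end Summit.BirchSwinnertonDyer.BirchSwinnertonDyer.Theorems.ManinLocalTwoThree.WeierstrassSqueeze

end
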